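import Summits.Ventures.PercRepro.RankDistMulti

/-!
# PercRepro — the cone above one set: the singleton case of the cumulative shadow inequality (p9, gen 17)

`RankDistCumulative.ShadowCumulative M p q` (the conjecture SC of this lane) compares the upper shadows `∂_u 𝓑` of the
bottom family. For ONE set `B` of rank `q` the comparison is a theorem: the rank-`q` supersets of `B` are the sets
between `B` and `cl(B)` (`2^{|cl B ∖ B|}` of them), the rank-`u` supersets contain every `B ∪ L ∪ S` with
`L ⊆ cl(B) ∖ B` and `S` a `(u − q)`-subset of a fixed independent set `J` over `B` of size `p − q`, and
`C(p−q, k)·C(q+k, k) ≥ C(p, k)` (`choose_sub_mul_choose_add_ge`, Vandermonde twice). Hence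
**`card_cone_mul_choose`**: `#{A ⊇ B : ρ(A) = q}·C(p+q, u) ≤ #{A ⊇ B : ρ(A) = u}·C(p+q, q)` for `q ≤ u ≤ p ≤ ρ(E)` —
coindependence of `B` is not even needed. Summed over a family this is the conjecture WITH MULTIPLICITIES
(`sum_card_cone_mul_choose`): the content of SC is the overlap of the cones. Nothing here is a statement about any
window of the crux.
-/

namespace PercRepro.RankDist

open Set Finset Matroid

variable {α : Type}

/-! ### The binomial inequality `C(p−q, k)·C(q+k, k) ≥ C(p, k)` -/

/-- `C(n, k)·C(k, j) ≥ C(n, k − j)` for `j ≤ k ≤ n`: the product is `C(n, k−j)·C(n−k+j, j)`. -/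
lemma choose_mul_choose_ge_choose_sub (n k j : ℕ) (hjk : j ≤ k) (hkn : k ≤ n) :
    n.choose (k - j) ≤ n.choose k * k.choose j := by
  have h := Nat.choose_mul (n := n) (k := k) (s := k - j) (Nat.sub_le k j)
  rw [Nat.choose_symm hjk] at h
  have hpos : 0 < (n - (k - j)).choose (k - (k - j)) := Nat.choose_pos (by omega)
  calc n.choose (k - j) = n.choose (k - j) * 1 := (mul_one _).symm
    _ ≤ n.choose (k - j) * (n - (k - j)).choose (k - (k - j)) := Nat.mul_le_mul_left _ hpos
    _ = n.choose k * k.choose j := h.symm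

/-- **`C(p, k) ≤ C(p−q, k)·C(q+k, k)`** for `q ≤ p` and `k ≤ p − q` (Vandermonde on both sides, then the lemma above
term by term). -/
theorem choose_le_choose_sub_mul_choose_add (p q k : ℕ) (hqp : q ≤ p) (hk : k ≤ p - q) :
    p.choose k ≤ (p - q).choose k * (q + k).choose k := by
  have hV1 := Nat.add_choose_eq q (p - q) k
  have hV2 := Nat.add_choose_eq q k k
  have hpq : q + (p - q) = p := by omega
  rw [hpq] at hV1
  rw [hV1, hV2, Finset.mul_sum]
  refine Finset.sum_le_sum fun ij hij => ?_
  rw [Finset.HasAntidiagonal.mem_antidiagonal] at hij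
  have h1 : ij.2 = k - ij.1 := by omega
  have h2 : (p - q).choose ij.2 ≤ (p - q).choose k * k.choose ij.1 := by
    rw [h1]; exact choose_mul_choose_ge_choose_sub (p - q) k ij.1 (by omega) hk
  have h3 : k.choose ij.1 = k.choose ij.2 := by
    rw [h1, Nat.choose_symm (by omega)]
  calc q.choose ij.1 * (p - q).choose ij.2
      ≤ q.choose ij.1 * ((p - q).choose k * k.choose ij.1) := Nat.mul_le_mul_left _ h2
    _ = (p - q).choose k * (q.choose ij.1 * k.choose ij.2) := by rw [h3]; ring

/-! ### An independent extension of prescribed size -/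

/-- **An independent `k`-extension of `B` outside its closure**: if `ρ(B) + k ≤ ρ(E)` there is a `k`-element finset
`J ⊆ E` disjoint from `cl(B)` with `ρ(B ∪ S) = ρ(B) + |S|` for every `S ⊆ J` (the `k` further elements of a base
through a basis of `B`). -/
theorem exists_ext_finset (M : Matroid α) [M.Finite] {B : Set α} (hB : B ⊆ M.E) (k r : ℕ)
    (hr : M.eRank = (r : ℕ∞)) (hk : rk M B + k ≤ r) :
    ∃ J : Finset α, (J : Set α) ⊆ M.E ∧ Disjoint (J : Set α) (M.closure B) ∧ J.card = k ∧
      ∀ S ⊆ J, M.eRk (B ∪ ↑S) = M.eRk B + (S.card : ℕ∞) := by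
  classical
  obtain ⟨IB, hIB⟩ := M.exists_isBasis B hB
  obtain ⟨I, hI, hIBI⟩ := hIB.indep.exists_isBase_superset
  have hIBcard : IB.encard = M.eRk B := hIB.eRk_eq_encard.symm
  have hIcard : I.encard = M.eRank := hI.encard_eq_eRank
  have hdiff : (k : ℕ∞) ≤ (I \ IB).encard := by
    have h := Set.encard_sdiff_add_encard_of_subset hIBI
    have hfinD : (I \ IB).Finite := M.ground_finite.subset (Set.sdiff_subset.trans hI.subset_ground)
    rw [hIcard, hIBcard, hr, eRk_eq_coe_rk M hB, hfinD.encard_eq_coe_toFinset_card] at h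
    have h' : hfinD.toFinset.card + rk M B = r := by exact_mod_cast h
    rw [hfinD.encard_eq_coe_toFinset_card]
    exact_mod_cast (by omega : k ≤ hfinD.toFinset.card)
  obtain ⟨J', hJ'sub, hJ'card⟩ := Set.exists_subset_encard_eq hdiff
  have hJ'E : J' ⊆ M.E := hJ'sub.trans (Set.sdiff_subset.trans hI.subset_ground)
  have hJ'fin : J'.Finite := M.ground_finite.subset hJ'E
  refine ⟨hJ'fin.toFinset, by rw [hJ'fin.coe_toFinset]; exact hJ'E, ?_, ?_, ?_⟩
  · rw [hJ'fin.coe_toFinset, Set.disjoint_left]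
    intro j hj hjcl
    have hjI : j ∈ I \ IB := hJ'sub hj
    rw [← hIB.closure_eq_closure] at hjcl
    have hind : M.Indep (insert j IB) := hI.indep.subset (Set.insert_subset hjI.1 hIBI)
    exact ((hIB.indep.notMem_closure_iff_of_notMem hjI.2 (hI.subset_ground hjI.1)).2 hind) hjcl
  · have := hJ'fin.encard_eq_coe_toFinset_card
    rw [hJ'card] at this
    exact_mod_cast this.symm
  · intro S hS
    have hSE : (S : Set α) ⊆ I \ IB := by
      intro e he
      exact hJ'sub (by rw [← hJ'fin.coe_toFinset]; exact Finset.coe_subset.2 hS he)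
    apply le_antisymm
    · exact eRk_union_le_add_card M B S
    · have hind : M.Indep (IB ∪ ↑S) :=
        hI.indep.subset (Set.union_subset hIBI (hSE.trans Set.sdiff_subset))
      have hdisj : Disjoint IB (S : Set α) := by
        rw [Set.disjoint_left]
        intro e heIB heS
        exact (hSE heS).2 heIB
      have h1 := hind.encard_le_eRk_of_subset (Set.union_subset_union hIB.subset (subset_refl _))
      rw [Set.encard_union_eq hdisj, hIBcard, Set.encard_coe_eq_coe_finsetCard] at h1
      exact h1

/-! ### The cone above a set -/

open scoped Classical in
/-- The cone above `B` at level `u`: the subsets `A ⊆ E` of rank `u` containing `B`. -/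
noncomputable def coneLev (M : Matroid α) [M.Finite] (B : Set α) (u : ℕ) : Finset (Set α) :=
  (subsetsFin M).filter (fun A => rk M A = u ∧ B ⊆ A)

/-- Membership in `coneLev`. -/
lemma mem_coneLev (M : Matroid α) [M.Finite] {B A : Set α} {u : ℕ} :
    A ∈ coneLev M B u ↔ A ⊆ M.E ∧ rk M A = u ∧ B ⊆ A := by
  unfold coneLev
  simp only [Finset.mem_filter, mem_subsetsFin]

/-- The elements of `cl(B) ∖ B`, as a finset. -/
noncomputable def clDiff (M : Matroid α) [M.Finite] (B : Set α) : Finset α :=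
  (show (M.closure B \ B).Finite from
    M.ground_finite.subset (Set.sdiff_subset.trans (M.closure_subset_ground B))).toFinset

/-- Membership in `clDiff`. -/
lemma mem_clDiff (M : Matroid α) [M.Finite] {B : Set α} {e : α} :
    e ∈ clDiff M B ↔ e ∈ M.closure B ∧ e ∉ B := by
  unfold clDiff
  rw [Set.Finite.mem_toFinset, Set.mem_sdiff]

/-- A superset of `B` of the same rank lies in `cl(B)`. -/
lemma subset_closure_of_mem_coneLev (M : Matroid α) [M.Finite] {B A : Set α} (hB : B ⊆ M.E)
    (hA : A ∈ coneLev M B (rk M B)) : A ⊆ M.closure B := by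
  rw [mem_coneLev] at hA
  obtain ⟨hAE, hAr, hBA⟩ := hA
  have hfin : M.IsRkFinite B := M.isRkFinite_of_finite (M.ground_finite.subset hB)
  have hle : M.eRk A ≤ M.eRk B := by rw [eRk_eq_coe_rk M hAE, eRk_eq_coe_rk M hB, hAr]
  have hcl := hfin.closure_eq_closure_of_subset_of_eRk_ge_eRk hBA hle
  rw [hcl]
  exact M.subset_closure A hAE

/-- **The base of the cone**: `#{A ⊇ B : ρ(A) = ρ(B)} ≤ 2^{|cl B ∖ B|}` (such an `A` lies between `B` and `cl(B)`). -/
theorem card_coneLev_rk_le (M : Matroid α) [M.Finite] {B : Set α} (hB : B ⊆ M.E) :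
    (coneLev M B (rk M B)).card ≤ 2 ^ (clDiff M B).card := by
  classical
  rw [← Finset.card_powerset]
  refine Finset.card_le_card_of_injOn (fun A => (clDiff M B).filter (fun e => e ∈ A)) ?_ ?_
  · intro A _
    rw [Finset.mem_coe, Finset.mem_powerset]
    exact Finset.filter_subset _ _
  · intro A hA A' hA' h
    rw [Finset.mem_coe] at hA hA'
    dsimp only at h
    have hAcl := subset_closure_of_mem_coneLev M hB hA
    have hA'cl := subset_closure_of_mem_coneLev M hB hA'
    have hBA := ((mem_coneLev M).1 hA).2.2
    have hBA' := ((mem_coneLev M).1 hA').2.2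
    ext e
    by_cases heB : e ∈ B
    · exact ⟨fun _ => hBA' heB, fun _ => hBA heB⟩
    · constructor
      · intro heA
        have hmem : e ∈ (clDiff M B).filter (fun e => e ∈ A) := by
          rw [Finset.mem_filter, mem_clDiff]; exact ⟨⟨hAcl heA, heB⟩, heA⟩
        rw [h, Finset.mem_filter] at hmem
        exact hmem.2
      · intro heA'
        have hmem : e ∈ (clDiff M B).filter (fun e => e ∈ A') := by
          rw [Finset.mem_filter, mem_clDiff]; exact ⟨⟨hA'cl heA', heB⟩, heA'⟩
        rw [← h, Finset.mem_filter] at hmem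
        exact hmem.2

/-- **The cone is at least a free cone**: with `J` an independent extension of `B` outside `cl(B)`
(`exists_ext_finset`), the sets `B ∪ L ∪ S`, `L ⊆ cl(B) ∖ B`, `S ⊆ J` of size `k`, are distinct supersets of `B` of
rank `ρ(B) + k`: `2^{|cl B ∖ B|}·C(|J|, k) ≤ #{A ⊇ B : ρ(A) = ρ(B) + k}`. -/
theorem card_coneLev_add_ge (M : Matroid α) [M.Finite] {B : Set α} (hB : B ⊆ M.E) (J : Finset α)
    (hJE : (J : Set α) ⊆ M.E) (hJcl : Disjoint (J : Set α) (M.closure B))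
    (hJ : ∀ S ⊆ J, M.eRk (B ∪ ↑S) = M.eRk B + (S.card : ℕ∞)) (k : ℕ) :
    2 ^ (clDiff M B).card * J.card.choose k ≤ (coneLev M B (rk M B + k)).card := by
  classical
  rw [← Finset.card_powerset, ← Finset.card_powersetCard, ← Finset.card_product]
  have hLcl : ∀ L ∈ (clDiff M B).powerset, (L : Set α) ⊆ M.closure B := by
    intro L hL e he
    rw [Finset.mem_powerset] at hL
    exact ((mem_clDiff M).1 (hL he)).1
  have hLB : ∀ L ∈ (clDiff M B).powerset, Disjoint (L : Set α) B := by
    intro L hL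
    rw [Finset.mem_powerset] at hL
    rw [Set.disjoint_left]
    intro e he heB
    exact ((mem_clDiff M).1 (hL he)).2 heB
  have hScl : ∀ S ∈ J.powersetCard k, Disjoint (S : Set α) (M.closure B) := by
    intro S hS
    rw [Finset.mem_powersetCard] at hS
    exact Set.disjoint_of_subset_left (Finset.coe_subset.2 hS.1) hJcl
  refine Finset.card_le_card_of_injOn (fun LS => B ∪ ↑LS.1 ∪ ↑LS.2) ?_ ?_
  · intro LS hLS
    rw [Finset.mem_coe, Finset.mem_product] at hLS
    obtain ⟨hL, hS⟩ := hLS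
    have hL' := hLcl LS.1 hL
    have hLE : (LS.1 : Set α) ⊆ M.E := hL'.trans (M.closure_subset_ground B)
    rw [Finset.mem_powersetCard] at hS
    have hSE : (LS.2 : Set α) ⊆ M.E := (Finset.coe_subset.2 hS.1).trans hJE
    have hAE : B ∪ ↑LS.1 ∪ ↑LS.2 ⊆ M.E := Set.union_subset (Set.union_subset hB hLE) hSE
    rw [Finset.mem_coe, mem_coneLev]
    refine ⟨hAE, ?_, Set.subset_union_left.trans Set.subset_union_left⟩
    have hclBL : M.closure (B ∪ ↑LS.1) = M.closure B := by
      apply le_antisymm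
      · exact M.closure_subset_closure_of_subset_closure (Set.union_subset (M.subset_closure B hB) hL')
      · exact M.closure_subset_closure Set.subset_union_left
    have h1 : M.eRk (B ∪ ↑LS.1 ∪ ↑LS.2) = M.eRk (B ∪ ↑LS.2) := by
      rw [← M.eRk_closure_eq (B ∪ ↑LS.1 ∪ ↑LS.2), Matroid.closure_union_congr_left hclBL, M.eRk_closure_eq]
    rw [rk_eq_iff M hAE, h1, hJ LS.2 hS.1, hS.2, eRk_eq_coe_rk M hB]
    push_cast; rfl
  · intro x hx y hy hxy
    rw [Finset.mem_coe, Finset.mem_product] at hx hy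
    dsimp only at hxy
    have hx1 := hLcl x.1 hx.1
    have hy1 := hLcl y.1 hy.1
    have hx1B := hLB x.1 hx.1
    have hy1B := hLB y.1 hy.1
    have hx2 := hScl x.2 hx.2
    have hy2 := hScl y.2 hy.2
    have hBcl : B ⊆ M.closure B := M.subset_closure B hB
    -- e ∈ x.2 ↔ e ∈ y.2 : e ∉ cl B, so in the union only through the S-part
    have h2 : x.2 = y.2 := by
      ext e
      constructor
      · intro he
        have hecl : e ∉ M.closure B := Set.disjoint_left.1 hx2 he
        have hmem : e ∈ B ∪ ↑x.1 ∪ ↑x.2 := Set.mem_union_right _ he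
        rw [hxy] at hmem
        rcases hmem with (hmem | hmem) | hmem
        · exact absurd (hBcl hmem) hecl
        · exact absurd (hy1 hmem) hecl
        · exact hmem
      · intro he
        have hecl : e ∉ M.closure B := Set.disjoint_left.1 hy2 he
        have hmem : e ∈ B ∪ ↑y.1 ∪ ↑y.2 := Set.mem_union_right _ he
        rw [← hxy] at hmem
        rcases hmem with (hmem | hmem) | hmem
        · exact absurd (hBcl hmem) hecl
        · exact absurd (hx1 hmem) hecl
        · exact hmem
    have h1 : x.1 = y.1 := by
      ext e
      constructor
      · intro he
        have hecl : e ∈ M.closure B := hx1 he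
        have heB : e ∉ B := Set.disjoint_left.1 hx1B he
        have hmem : e ∈ B ∪ ↑x.1 ∪ ↑x.2 := Set.mem_union_left _ (Set.mem_union_right _ he)
        rw [hxy] at hmem
        rcases hmem with (hmem | hmem) | hmem
        · exact absurd hmem heB
        · exact hmem
        · exact absurd hecl (Set.disjoint_left.1 hy2 hmem)
      · intro he
        have hecl : e ∈ M.closure B := hy1 he
        have heB : e ∉ B := Set.disjoint_left.1 hy1B he
        have hmem : e ∈ B ∪ ↑y.1 ∪ ↑y.2 := Set.mem_union_left _ (Set.mem_union_right _ he)
        rw [← hxy] at hmem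
        rcases hmem with (hmem | hmem) | hmem
        · exact absurd hmem heB
        · exact hmem
        · exact absurd hecl (Set.disjoint_left.1 hx2 hmem)
    exact Prod.ext h1 h2

/-- **THE CONE ABOVE ONE SET GROWS BINOMIALLY** (the singleton case of the cumulative shadow inequality, for ANY set
`B` of rank `q`, `q ≤ u ≤ p ≤ ρ(E)`): `#{A ⊇ B : ρ(A) = q}·C(p+q, u) ≤ #{A ⊇ B : ρ(A) = u}·C(p+q, q)`. -/
theorem card_cone_mul_choose (M : Matroid α) [M.Finite] (p q u r : ℕ) (hr : M.eRank = (r : ℕ∞)) (hp : p ≤ r)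
    {B : Set α} (hB : B ⊆ M.E) (hBq : rk M B = q) (hqu : q ≤ u) (hup : u ≤ p) :
    (coneLev M B q).card * (p + q).choose u ≤ (coneLev M B u).card * (p + q).choose q := by
  classical
  obtain ⟨J, hJE, hJcl, hJcard, hJ⟩ := exists_ext_finset M hB (p - q) r hr (by omega)
  have h1 := card_coneLev_rk_le M hB
  have h2 := card_coneLev_add_ge M hB J hJE hJcl hJ (u - q)
  rw [hJcard] at h2
  rw [hBq] at h1 h2
  have huq : q + (u - q) = u := by omega
  rw [huq] at h2
  have hbin := choose_le_choose_sub_mul_choose_add p q (u - q) (by omega) (by omega)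
  rw [huq] at hbin
  have hid := Nat.choose_mul (n := p + q) (k := u) (s := q) hqu
  rw [Nat.add_sub_cancel] at hid
  have hCuq : 0 < u.choose q := Nat.choose_pos hqu
  refine Nat.le_of_mul_le_mul_right ?_ hCuq
  calc (coneLev M B q).card * (p + q).choose u * u.choose q
      = (coneLev M B q).card * ((p + q).choose q * p.choose (u - q)) := by rw [mul_assoc, hid]
    _ ≤ 2 ^ (clDiff M B).card * ((p + q).choose q * ((p - q).choose (u - q) * u.choose (u - q))) := by
        refine Nat.mul_le_mul h1 (Nat.mul_le_mul_left _ hbin)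
    _ = (2 ^ (clDiff M B).card * (p - q).choose (u - q)) * (p + q).choose q * u.choose q := by
        rw [Nat.choose_symm hqu]; ring
    _ ≤ (coneLev M B u).card * (p + q).choose q * u.choose q :=
        Nat.mul_le_mul_right _ (Nat.mul_le_mul_right _ h2)

/-- **THE CUMULATIVE SHADOW INEQUALITY HOLDS WITH MULTIPLICITIES**: for any family `𝒜` of rank-`q` subsets of `E`,
`(Σ_{B ∈ 𝒜} #{A ⊇ B : ρ(A) = q})·C(p+q, u) ≤ (Σ_{B ∈ 𝒜} #{A ⊇ B : ρ(A) = u})·C(p+q, q)` — the sums count the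
members of the shadows `∂_q 𝒜`, `∂_u 𝒜` with the multiplicity `#{B ∈ 𝒜 : B ⊆ A}`; what separates this from
`ShadowCumulative` is the overlap of the cones. -/
theorem sum_card_cone_mul_choose (M : Matroid α) [M.Finite] (p q u r : ℕ) (hr : M.eRank = (r : ℕ∞)) (hp : p ≤ r)
    (𝒜 : Finset (Set α)) (h𝒜 : ∀ B ∈ 𝒜, B ⊆ M.E ∧ rk M B = q) (hqu : q ≤ u) (hup : u ≤ p) :
    (∑ B ∈ 𝒜, (coneLev M B q).card) * (p + q).choose u
      ≤ (∑ B ∈ 𝒜, (coneLev M B u).card) * (p + q).choose q := by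
  rw [Finset.sum_mul, Finset.sum_mul]
  exact Finset.sum_le_sum fun B hB => card_cone_mul_choose M p q u r hr hp (h𝒜 B hB).1 (h𝒜 B hB).2 hqu hup

end PercRepro.RankDist
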